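import Mathlib.Algebra.Polynomial.Inductions
import Mathlib.Algebra.BigOperators.Field
import Mathlib.Analysis.Calculus.Deriv.Polynomial
import Mathlib.Analysis.Calculus.ContDiff.Polynomial
import Literature.Analysis.Fourier.AutocorrelationBumps
import Literature.Analysis.Fourier.ChebyshevDerivativeBounds
import Literature.Analysis.Fourier.ArccosCompositionBounds
import HarnessLib

/-!
# Smooth-profile Chebyshev low-pass polynomials in the multiplier variable

Topic `Literature/Analysis/Fourier`.  The one-variable polynomial family behind the finite-range
decomposition with regularity of all orders in the coefficients (Buchholz, J. Funct. Anal. 275 (2018),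
Thm 2.4 / Lemma 5.1; Bauerschmidt 2013, Lemma 2.3): for a band `B > 0` and integers `1 ≤ m ≤ t`, `t ≥ 2`,

  `G_{B,m,t}(a) = A_{𝟙,m}(θ) · A_{plateau,t}(θ)`,   `cos θ = 1 − a/(2B)`   (`lowPass B m t a`),

the product of the normalised Fejér kernel and the smooth-profile autocorrelation bump of
`AutocorrelationBumps.lean`, written as a POLYNOMIAL of degree `≤ m + t` in `a` (`lowPassPoly`, via the
Chebyshev polynomials `T_{ν−ν'}`).  As an operator `G(𝒜)` for a range-one lattice operator `𝒜` with
spectrum in `[0, 2B]` it has range `≤ m + t`.  We prove the "symbol" properties used by the decomposition: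

* `lowPass_zero` (`G(0) = 1`), `lowPass_nonneg`, `lowPass_le_one` on `[0, 4B]`;
* FLATNESS `1 − G(a) ≤ (m² + t²) π² a / (8B)` (`one_sub_lowPass_le`) and the LOWER bound
  `1 − G(a) ≥ min((m+1)² a /(4π² B), 2/5)` on `(0, 2B]` (`one_sub_lowPass_ge`) — Buchholz's (5.4);
* the all-order SYMBOL ESTIMATE (5.3): for all `i, j` a constant `C` with
  `|G^{(i)}(a)| ≤ C (t²/B)^i min(1, (t² a/B)^{-j})` on `(0, 2B]` (`exists_abs_iteratedDeriv_lowPass_le`):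
  the bulk from V. A. Markov's bound for nonnegative Chebyshev combinations
  (`ChebyshevDerivativeBounds.lean`), the tail from the summation-by-parts bounds in the angle variable
  (`AutocorrelationBumps.lean`) transferred to `x = cos θ` (`ArccosCompositionBounds.lean`).

Everything is proved; no named facts.

## References
* S. Buchholz, *Finite range decomposition for Gaussian measures with improved regularity*,
  J. Funct. Anal. 275 (2018), Lemma 5.1 (5.2)–(5.4) [Buchholz2016].
* R. Bauerschmidt, Probab. Theory Relat. Fields 157 (2013), Lemma 2.3 [Bauerschmidt2013].
-/

noncomputable section

open Finset Polynomial Polynomial.Chebyshev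
open scoped Real

namespace Literature.Analysis.Fourier

/-! ## Autocorrelation bumps as Chebyshev polynomials -/

/-- The index set `{0,…,t}²` of an autocorrelation. [cite: Buchholz2016, Lemma 5.1 (proof)] -/
def acIndex (t : ℕ) : Finset (ℤ × ℤ) := Finset.Icc (0 : ℤ) t ×ˢ Finset.Icc (0 : ℤ) t

/-- The weights `s(ν/t) s(ν'/t) / V(0)²` of the autocorrelation. [cite: Buchholz2016, Lemma 5.1 (proof)] -/
def acWeight (s : ℝ → ℝ) (t : ℕ) (k : ℤ × ℤ) : ℝ :=
  s ((k.1 : ℝ) / t) * s ((k.2 : ℝ) / t) / profMass s t ^ 2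

/-- The autocorrelation bump as a Chebyshev polynomial:
`acPoly s t = Σ_{ν,ν'} (s(ν/t)s(ν'/t)/V(0)²) T_{ν−ν'}`, so that `acPoly(cos θ) = A_{s,t}(θ)`
(Bauerschmidt's `W_t = Σ_ν φ̂(ν/t) T_ν(1 − λ/2B)`). [cite: Bauerschmidt2013, Lemma 2.3] -/
def acPoly (s : ℝ → ℝ) (t : ℕ) : ℝ[X] := ∑ k ∈ acIndex t, acWeight s t k • T ℝ (k.1 - k.2)

/-- Nonnegative profiles have nonnegative weights. [cite: Buchholz2016, Lemma 5.1 (proof)] -/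
theorem acWeight_nonneg {s : ℝ → ℝ} (hs : ∀ x, 0 ≤ s x) (t : ℕ) (k : ℤ × ℤ) : 0 ≤ acWeight s t k := by
  unfold acWeight; exact div_nonneg (mul_nonneg (hs _) (hs _)) (sq_nonneg _)

/-- The frequencies `ν − ν'` are bounded by `t`. [cite: Buchholz2016, Lemma 5.1 (proof)] -/
theorem abs_sub_le_of_mem_acIndex {t : ℕ} {k : ℤ × ℤ} (hk : k ∈ acIndex t) : |k.1 - k.2| ≤ (t : ℤ) := by
  unfold acIndex at hk
  rw [Finset.mem_product, Finset.mem_Icc, Finset.mem_Icc] at hk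
  rw [abs_le]; omega

/-- The total weight is `V(0)²/V(0)² ≤ 1` (`= 1` when the mass is positive). [cite: Buchholz2016, Lemma 5.1 (proof)] -/
theorem sum_acWeight_eq (s : ℝ → ℝ) (t : ℕ) :
    ∑ k ∈ acIndex t, acWeight s t k = profMass s t ^ 2 / profMass s t ^ 2 := by
  unfold acIndex acWeight
  rw [Finset.sum_product, profMass, sq, Finset.sum_mul_sum, Finset.sum_div]
  refine sum_congr rfl fun ν _ => ?_
  rw [Finset.sum_div]

/-- `Σ_k w_k ≤ 1`. [cite: Buchholz2016, Lemma 5.1 (proof)] -/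
theorem sum_acWeight_le_one (s : ℝ → ℝ) (t : ℕ) : ∑ k ∈ acIndex t, acWeight s t k ≤ 1 := by
  rw [sum_acWeight_eq]
  rcases eq_or_ne (profMass s t ^ 2) 0 with h | h
  · rw [h]; simp
  · rw [div_self h]

/-- `Σ_k w_k = 1` for positive mass. [cite: Buchholz2016, Lemma 5.1 (proof)] -/
theorem sum_acWeight_eq_one {s : ℝ → ℝ} {t : ℕ} (h : 0 < profMass s t) : ∑ k ∈ acIndex t, acWeight s t k = 1 := by
  rw [sum_acWeight_eq, div_self (by positivity)]

/-- **`acPoly(cos θ) = A_{s,t}(θ)`**. [cite: Bauerschmidt2013, Lemma 2.3] -/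
theorem acPoly_eval_cos (s : ℝ → ℝ) (t : ℕ) (θ : ℝ) : (acPoly s t).eval (Real.cos θ) = acBump s t θ := by
  unfold acPoly
  rw [eval_chebComb_cos, acIndex, Finset.sum_product, acBump, norm_sq_profSum_cprof, Finset.sum_div]
  refine sum_congr rfl fun ν _ => ?_
  rw [Finset.sum_div]
  refine sum_congr rfl fun ν' _ => ?_
  unfold acWeight
  push_cast
  ring

/-- `acPoly(1) = Σ_k w_k`. [cite: Buchholz2016, Lemma 5.1 (proof)] -/
theorem acPoly_eval_one (s : ℝ → ℝ) (t : ℕ) : (acPoly s t).eval 1 = ∑ k ∈ acIndex t, acWeight s t k := by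
  have h := acPoly_eval_cos s t 0
  rw [Real.cos_zero] at h
  rw [h, acBump, profSum_cprof_zero, Complex.norm_real, Real.norm_eq_abs, sq_abs, sum_acWeight_eq]

/-- `deg acPoly ≤ t`. [cite: Bauerschmidt2013, Lemma 2.3] -/
theorem natDegree_acPoly_le (s : ℝ → ℝ) (t : ℕ) : (acPoly s t).natDegree ≤ t := by
  unfold acPoly
  refine Polynomial.natDegree_sum_le_of_forall_le _ _ fun k hk => ?_
  refine (Polynomial.natDegree_smul_le _ _).trans ?_
  rw [Polynomial.Chebyshev.natDegree_T]
  have := abs_sub_le_of_mem_acIndex hk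
  have h2 : ((k.1 - k.2).natAbs : ℤ) ≤ t := by rw [Int.natCast_natAbs]; exact this
  exact_mod_cast h2

/-- **Bulk bound** `|acPoly^{(i)}(x)| ≤ t^{2i}` on `[-1,1]` for a nonnegative profile (V. A. Markov for a
nonnegative Chebyshev combination of total weight `≤ 1`). [cite: Buchholz2016, Lemma 5.1 (5.3)] -/
theorem abs_iterate_derivative_acPoly_le {s : ℝ → ℝ} (hs : ∀ x, 0 ≤ s x) (t i : ℕ) {x : ℝ}
    (hx : x ∈ Set.Icc (-1 : ℝ) 1) : |(derivative^[i] (acPoly s t)).eval x| ≤ (t : ℝ) ^ (2 * i) := by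
  unfold acPoly
  refine (abs_iterate_derivative_chebComb_le (acIndex t) (acWeight s t) (fun k => k.1 - k.2) t
    (fun k _ => acWeight_nonneg hs t k) (fun k hk => abs_sub_le_of_mem_acIndex hk) i hx).trans ?_
  calc (t : ℝ) ^ (2 * i) * ∑ k ∈ acIndex t, acWeight s t k ≤ (t : ℝ) ^ (2 * i) * 1 :=
        mul_le_mul_of_nonneg_left (sum_acWeight_le_one s t) (by positivity)
    _ = (t : ℝ) ^ (2 * i) := mul_one _

/-! ## The low-pass product: Fejér factor times smooth-profile factor -/

/-- The low-pass bump as a Chebyshev polynomial: `P_{m,t} = acPoly(𝟙,m) · acPoly(plateau,t)`.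
[cite: Buchholz2016, Lemma 5.1 (5.2)] -/
def bumpPoly (m t : ℕ) : ℝ[X] := acPoly boxProf m * acPoly plateau t

/-- The low-pass bump in the angle: `F_{m,t}(θ) = A_{𝟙,m}(θ) A_{plateau,t}(θ)`. [cite: Buchholz2016, Lemma 5.1 (5.2)] -/
def bumpAngle (m t : ℕ) (θ : ℝ) : ℝ := acBump boxProf m θ * acBump plateau t θ

/-- `P_{m,t}(cos θ) = F_{m,t}(θ)`. [cite: Buchholz2016, Lemma 5.1 (5.2)] -/
theorem bumpPoly_eval_cos (m t : ℕ) (θ : ℝ) : (bumpPoly m t).eval (Real.cos θ) = bumpAngle m t θ := by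
  rw [bumpPoly, eval_mul, acPoly_eval_cos, acPoly_eval_cos, bumpAngle]

/-- `deg P_{m,t} ≤ m + t`. [cite: Buchholz2016, Lemma 5.1 ("polynomial of degree at most t")] -/
theorem natDegree_bumpPoly_le (m t : ℕ) : (bumpPoly m t).natDegree ≤ m + t :=
  (Polynomial.natDegree_mul_le).trans (add_le_add (natDegree_acPoly_le _ _) (natDegree_acPoly_le _ _))

/-- The masses are positive: `V_{𝟙,m}(0) = m+1 > 0`. [cite: Buchholz2016, Lemma 5.1 (proof)] -/
theorem profMass_boxProf_pos {m : ℕ} (hm : 1 ≤ m) : 0 < profMass boxProf m := by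
  rw [profMass_boxProf hm]; positivity

/-- `V_{plateau,t}(0) ≥ t/4 > 0` for `t ≥ 2`. [cite: Buchholz2016, Lemma 5.1 (proof)] -/
theorem profMass_plateau_pos {t : ℕ} (ht : 2 ≤ t) : 0 < profMass plateau t := by
  have h0 : (0 : ℝ) < t := by exact_mod_cast (show 0 < t by omega)
  exact lt_of_lt_of_le (div_pos h0 (by norm_num)) (profMass_plateau_ge ht)

/-- `P_{m,t}(1) = 1`. [cite: Buchholz2016, Lemma 5.1 (proof)] -/
theorem bumpPoly_eval_one {m t : ℕ} (hm : 1 ≤ m) (ht : 2 ≤ t) : (bumpPoly m t).eval 1 = 1 := by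
  rw [bumpPoly, eval_mul, acPoly_eval_one, acPoly_eval_one, sum_acWeight_eq_one (profMass_boxProf_pos hm),
    sum_acWeight_eq_one (profMass_plateau_pos ht), mul_one]

/-- `0 ≤ F_{m,t} ≤ 1`. [cite: Buchholz2016, Lemma 5.1 (5.2)] -/
theorem bumpAngle_mem_Icc (m t : ℕ) (θ : ℝ) : bumpAngle m t θ ∈ Set.Icc (0 : ℝ) 1 :=
  ⟨mul_nonneg (acBump_nonneg _ _ _) (acBump_nonneg _ _ _),
    mul_le_one₀ (acBump_le_one boxProf_nonneg _ _) (acBump_nonneg _ _ _) (acBump_le_one plateau_nonneg _ _)⟩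

/-- **Bulk bound for the product** `|P_{m,t}^{(n)}(x)| ≤ 2^n t^{2n}` on `[-1,1]`, `m ≤ t` (Leibniz).
[cite: Buchholz2016, Lemma 5.1 (5.3)] -/
theorem abs_iterate_derivative_bumpPoly_le {m t : ℕ} (hmt : m ≤ t) (n : ℕ) {x : ℝ} (hx : x ∈ Set.Icc (-1 : ℝ) 1) :
    |(derivative^[n] (bumpPoly m t)).eval x| ≤ 2 ^ n * (t : ℝ) ^ (2 * n) := by
  rw [bumpPoly, Polynomial.iterate_derivative_mul, eval_finsetSum]
  refine (abs_sum_le_sum_abs _ _).trans ?_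
  have hterm : ∀ k ∈ Finset.range n.succ, |eval x (n.choose k • ((derivative^[n - k] (acPoly boxProf m)) *
      (derivative^[k] (acPoly plateau t))))| ≤ (n.choose k : ℝ) * (t : ℝ) ^ (2 * n) := by
    intro k hk
    rw [Finset.mem_range] at hk
    rw [eval_smul, eval_mul, nsmul_eq_mul, abs_mul, abs_mul, Nat.abs_cast]
    have h1 := abs_iterate_derivative_acPoly_le boxProf_nonneg m (n - k) hx
    have h2 := abs_iterate_derivative_acPoly_le plateau_nonneg t k hx
    have hm : (m : ℝ) ^ (2 * (n - k)) ≤ (t : ℝ) ^ (2 * (n - k)) :=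
      pow_le_pow_left₀ (Nat.cast_nonneg _) (by exact_mod_cast hmt) _
    refine mul_le_mul_of_nonneg_left ?_ (Nat.cast_nonneg _)
    calc |eval x ((derivative^[n - k]) (acPoly boxProf m))| * |eval x ((derivative^[k]) (acPoly plateau t))|
        ≤ (t : ℝ) ^ (2 * (n - k)) * (t : ℝ) ^ (2 * k) := mul_le_mul (h1.trans hm) h2 (abs_nonneg _) (by positivity)
      _ = (t : ℝ) ^ (2 * n) := by rw [← pow_add]; congr 1; omega
  refine (sum_le_sum hterm).trans (le_of_eq ?_)
  rw [← sum_mul, Nat.succ_eq_add_one]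
  congr 1
  exact_mod_cast Nat.sum_range_choose n

/-- Iterated derivatives of a polynomial function are evaluations of the formal iterated derivatives. [folklore] -/
private theorem iteratedDeriv_poly_eval (P : ℝ[X]) :
    ∀ i : ℕ, iteratedDeriv i (fun x => P.eval x) = fun x => (derivative^[i] P).eval x
  | 0 => by simp
  | i + 1 => by
    rw [iteratedDeriv_succ, iteratedDeriv_poly_eval P i, Function.iterate_succ_apply']
    funext x
    exact Polynomial.deriv _

/-- The bulk bound in analytic form: `|(d/dx)^n P_{m,t}(x)| ≤ 2^n t^{2n}` on `[-1,1]`.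
[cite: Buchholz2016, Lemma 5.1 (5.3)] -/
theorem abs_iteratedDeriv_bumpPoly_le {m t : ℕ} (hmt : m ≤ t) (n : ℕ) {x : ℝ} (hx : x ∈ Set.Icc (-1 : ℝ) 1) :
    |iteratedDeriv n (fun y => (bumpPoly m t).eval y) x| ≤ 2 ^ n * (t : ℝ) ^ (2 * n) := by
  rw [iteratedDeriv_poly_eval]
  exact abs_iterate_derivative_bumpPoly_le hmt n hx

/-! ## Angle-derivative bounds for the product -/

/-- `F_{m,t}` is smooth. [cite: Buchholz2016, Lemma 5.1 (proof)] -/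
theorem contDiff_bumpAngle (m t : ℕ) (n : ℕ) : ContDiff ℝ n (bumpAngle m t) :=
  (contDiff_acBump boxProf m).mul (contDiff_acBump plateau t)

/-- **Trivial angle-derivative bound** `|F^{(n)}(θ)| ≤ 4^n t^n` (`1 ≤ m ≤ t`, `t ≥ 2`).
[cite: Buchholz2016, Lemma 5.1 (5.3), n = 0] -/
theorem abs_iteratedDeriv_bumpAngle_le {m t : ℕ} (hm : 1 ≤ m) (ht : 2 ≤ t) (hmt : m ≤ t) (n : ℕ) (θ : ℝ) :
    |iteratedDeriv n (bumpAngle m t) θ| ≤ 4 ^ n * (t : ℝ) ^ n := by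
  have hL := norm_iteratedFDeriv_mul_le (f := acBump boxProf m) (g := acBump plateau t)
    (contDiff_acBump boxProf m (n := (n : WithTop ℕ∞))) (contDiff_acBump plateau t (n := (n : WithTop ℕ∞))) θ
    (n := n) le_rfl
  rw [← Real.norm_eq_abs, ← norm_iteratedFDeriv_eq_norm_iteratedDeriv]
  refine (le_of_eq (by rfl)).trans (hL.trans ?_)
  have hterm : ∀ i ∈ Finset.range (n + 1), (n.choose i : ℝ) * ‖iteratedFDeriv ℝ i (acBump boxProf m) θ‖ *
      ‖iteratedFDeriv ℝ (n - i) (acBump plateau t) θ‖ ≤ (n.choose i : ℝ) * (2 ^ n * (t : ℝ) ^ n) := by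
    intro i hi
    rw [Finset.mem_range] at hi
    rw [norm_iteratedFDeriv_eq_norm_iteratedDeriv, norm_iteratedFDeriv_eq_norm_iteratedDeriv, Real.norm_eq_abs,
      Real.norm_eq_abs, mul_assoc]
    refine mul_le_mul_of_nonneg_left ?_ (Nat.cast_nonneg _)
    have h1 := abs_iteratedDeriv_acBump_le boxProf_nonneg (profMass_boxProf_pos hm) i θ
    have h2 := abs_iteratedDeriv_acBump_le plateau_nonneg (profMass_plateau_pos ht) (n - i) θ
    have hm' : (m : ℝ) ^ i ≤ (t : ℝ) ^ i := pow_le_pow_left₀ (Nat.cast_nonneg _) (by exact_mod_cast hmt) _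
    calc |iteratedDeriv i (acBump boxProf m) θ| * |iteratedDeriv (n - i) (acBump plateau t) θ|
        ≤ (2 ^ i * (t : ℝ) ^ i) * (2 ^ (n - i) * (t : ℝ) ^ (n - i)) :=
          mul_le_mul (h1.trans (mul_le_mul_of_nonneg_left hm' (by positivity))) h2 (abs_nonneg _) (by positivity)
      _ = 2 ^ (i + (n - i)) * (t : ℝ) ^ (i + (n - i)) := by rw [pow_add, pow_add]; ring
      _ = 2 ^ n * (t : ℝ) ^ n := by rw [show i + (n - i) = n by omega]
  refine (sum_le_sum hterm).trans (le_of_eq ?_)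
  rw [← sum_mul, show (4 : ℝ) ^ n = 2 ^ n * 2 ^ n by rw [← mul_pow]; norm_num]
  have : ∑ i ∈ Finset.range (n + 1), (n.choose i : ℝ) = 2 ^ n := by exact_mod_cast Nat.sum_range_choose n
  rw [this]; ring

/-- **Tail angle-derivative bound**: for all `n, j` there is `C` with `|F_{m,t}^{(n)}(θ)| ≤ C t^n (t|θ|)^{-j}` for
`1 ≤ m ≤ t`, `t ≥ 2`, `0 < |θ| ≤ π` (the smooth-profile factor supplies the decay).
[cite: Buchholz2016, Lemma 5.1 (5.3)] -/
theorem exists_abs_iteratedDeriv_bumpAngle_le_tail (n j : ℕ) : ∃ C, 0 ≤ C ∧ ∀ m t : ℕ, 1 ≤ m → 2 ≤ t → m ≤ t →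
    ∀ θ : ℝ, θ ≠ 0 → |θ| ≤ π → |iteratedDeriv n (bumpAngle m t) θ| ≤ C * (t : ℝ) ^ n / ((t : ℝ) * |θ|) ^ j := by
  have htail : ∀ i : ℕ, ∃ C, 0 ≤ C ∧ ∀ t : ℕ, 1 ≤ t → (1 / 4 : ℝ) * t ≤ profMass plateau t → ∀ θ : ℝ, θ ≠ 0 →
      |θ| ≤ π → |iteratedDeriv i (acBump plateau t) θ| ≤ C * (t : ℝ) ^ i / ((t : ℝ) * |θ|) ^ j :=
    fun i => exists_abs_iteratedDeriv_acBump_le_tail plateau_nonneg contDiff_plateau (fun x hx => plateau_eq_zero hx)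
      (by norm_num) i j
  choose C hC0 hC using htail
  set Cs : ℝ := ∑ i ∈ Finset.range (n + 1), (n.choose i : ℝ) * (2 ^ n * C i) with hCs
  refine ⟨Cs, sum_nonneg fun i _ => by have := hC0 i; positivity, fun m t hm ht hmt θ hθ0 hθπ => ?_⟩
  have ht1 : 1 ≤ t := by omega
  have hmass : (1 / 4 : ℝ) * t ≤ profMass plateau t := by
    have := profMass_plateau_ge ht; linarith
  have htpos : (0 : ℝ) < t := by exact_mod_cast (show 0 < t by omega)
  have hden : 0 < ((t : ℝ) * |θ|) ^ j := by have := abs_pos.2 hθ0; positivity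
  have hL := norm_iteratedFDeriv_mul_le (f := acBump boxProf m) (g := acBump plateau t)
    (contDiff_acBump boxProf m (n := (n : WithTop ℕ∞))) (contDiff_acBump plateau t (n := (n : WithTop ℕ∞))) θ
    (n := n) le_rfl
  rw [← Real.norm_eq_abs, ← norm_iteratedFDeriv_eq_norm_iteratedDeriv]
  refine (le_of_eq (by rfl)).trans (hL.trans ?_)
  have hterm : ∀ i ∈ Finset.range (n + 1), (n.choose i : ℝ) * ‖iteratedFDeriv ℝ i (acBump boxProf m) θ‖ *
      ‖iteratedFDeriv ℝ (n - i) (acBump plateau t) θ‖ ≤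
      (n.choose i : ℝ) * (2 ^ n * C (n - i)) * ((t : ℝ) ^ n / ((t : ℝ) * |θ|) ^ j) := by
    intro i hi
    rw [Finset.mem_range] at hi
    rw [norm_iteratedFDeriv_eq_norm_iteratedDeriv, norm_iteratedFDeriv_eq_norm_iteratedDeriv, Real.norm_eq_abs,
      Real.norm_eq_abs, mul_assoc, mul_assoc]
    refine mul_le_mul_of_nonneg_left ?_ (Nat.cast_nonneg _)
    have h1 := abs_iteratedDeriv_acBump_le boxProf_nonneg (profMass_boxProf_pos hm) i θ
    have h2 := hC (n - i) t ht1 hmass θ hθ0 hθπ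
    have hm' : (m : ℝ) ^ i ≤ (t : ℝ) ^ i := pow_le_pow_left₀ (Nat.cast_nonneg _) (by exact_mod_cast hmt) _
    have h2i : (2 : ℝ) ^ i ≤ 2 ^ n := pow_le_pow_right₀ (by norm_num) (by omega)
    calc |iteratedDeriv i (acBump boxProf m) θ| * |iteratedDeriv (n - i) (acBump plateau t) θ|
        ≤ (2 ^ i * (t : ℝ) ^ i) * (C (n - i) * (t : ℝ) ^ (n - i) / ((t : ℝ) * |θ|) ^ j) :=
          mul_le_mul (h1.trans (mul_le_mul_of_nonneg_left hm' (by positivity))) h2 (abs_nonneg _) (by positivity)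
      _ = 2 ^ i * C (n - i) * ((t : ℝ) ^ (i + (n - i)) / ((t : ℝ) * |θ|) ^ j) := by rw [pow_add]; ring
      _ = 2 ^ i * C (n - i) * ((t : ℝ) ^ n / ((t : ℝ) * |θ|) ^ j) := by rw [show i + (n - i) = n by omega]
      _ ≤ 2 ^ n * C (n - i) * ((t : ℝ) ^ n / ((t : ℝ) * |θ|) ^ j) :=
          mul_le_mul_of_nonneg_right (mul_le_mul_of_nonneg_right h2i (hC0 _)) (by positivity)
  refine (sum_le_sum hterm).trans (le_of_eq ?_)
  rw [← sum_mul, hCs]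
  have hre : ∑ i ∈ Finset.range (n + 1), (n.choose i : ℝ) * (2 ^ n * C (n - i)) =
      ∑ i ∈ Finset.range (n + 1), (n.choose i : ℝ) * (2 ^ n * C i) := by
    rw [← Finset.sum_range_reflect]
    refine sum_congr rfl fun i hi => ?_
    rw [Finset.mem_range] at hi
    rw [show n + 1 - 1 - i = n - i by omega, Nat.choose_symm (by omega : i ≤ n), show n - (n - i) = i by omega]
  rw [hre]
  ring

/-! ## Transfer to the variable `x = cos θ` -/

/-- On `(-1,1)` the polynomial function `P_{m,t}` is `F_{m,t} ∘ arccos`. [cite: Buchholz2016, Lemma 5.1 (proof)] -/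
theorem bumpPoly_eval_eq_bumpAngle_arccos (m t : ℕ) {y : ℝ} (hy : y ∈ Set.Icc (-1 : ℝ) 1) :
    (bumpPoly m t).eval y = bumpAngle m t (Real.arccos y) := by
  rw [← bumpPoly_eval_cos, Real.cos_arccos hy.1 hy.2]

/-- **Tail bound in `x`**: for all `n, j` there is `C` with
`|(d/dx)^n P_{m,t}(y)| ≤ C (t/θ)^n (tθ)^{-j}` for `0 ≤ y < 1`, `θ = arccos y`, `tθ ≥ 1` (`1 ≤ m ≤ t`, `t ≥ 2`).
[cite: Buchholz2016, Lemma 5.1 (5.3)] -/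
theorem exists_abs_iteratedDeriv_bumpPoly_le_tail (n j : ℕ) : ∃ C, 0 ≤ C ∧ ∀ m t : ℕ, 1 ≤ m → 2 ≤ t → m ≤ t →
    ∀ y : ℝ, 0 ≤ y → y < 1 → 1 ≤ (t : ℝ) * Real.arccos y →
      |iteratedDeriv n (fun x => (bumpPoly m t).eval x) y| ≤
        C * ((t : ℝ) / Real.arccos y) ^ n / ((t : ℝ) * Real.arccos y) ^ j := by
  obtain ⟨K, hK, hcomp⟩ := exists_abs_iteratedDeriv_comp_arccos_le n
  have htail : ∀ i : ℕ, ∃ C, 0 ≤ C ∧ ∀ m t : ℕ, 1 ≤ m → 2 ≤ t → m ≤ t → ∀ θ : ℝ, θ ≠ 0 → |θ| ≤ π →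
      |iteratedDeriv i (bumpAngle m t) θ| ≤ C * (t : ℝ) ^ i / ((t : ℝ) * |θ|) ^ j :=
    fun i => exists_abs_iteratedDeriv_bumpAngle_le_tail i j
  choose C hC0 hC using htail
  set Cs : ℝ := ∑ i ∈ Finset.range (n + 1), C i with hCs
  have hCs0 : 0 ≤ Cs := sum_nonneg fun i _ => hC0 i
  have hCi : ∀ i, i ≤ n → C i ≤ Cs := fun i hi =>
    single_le_sum (f := C) (fun i _ => hC0 i) (Finset.mem_range.2 (by omega))
  refine ⟨K * Cs, by positivity, fun m t hm ht hmt y hy0 hy1 hfar => ?_⟩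
  set θ := Real.arccos y with hθ
  have hθpos : 0 < θ := Real.arccos_pos.2 hy1
  have hθπ : |θ| ≤ π := by rw [abs_of_pos hθpos]; exact Real.arccos_le_pi y
  have htpos : (0 : ℝ) < t := by exact_mod_cast (show 0 < t by omega)
  have hden : 0 < ((t : ℝ) * θ) ^ j := by positivity
  -- the polynomial function agrees with `F ∘ arccos` near `y`
  have hev : (fun x => (bumpPoly m t).eval x) =ᶠ[nhds y] fun x => bumpAngle m t (Real.arccos x) := by
    filter_upwards [isOpen_Ioo.mem_nhds (show y ∈ Set.Ioo (-1 : ℝ) 1 from ⟨by linarith, hy1⟩)] with z hz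
      using bumpPoly_eval_eq_bumpAngle_arccos m t ⟨hz.1.le, hz.2.le⟩
  rw [hev.iteratedDeriv_eq n]
  have hA : ∀ i, i ≤ n → |iteratedDeriv i (bumpAngle m t) (Real.arccos y)| ≤ Cs / ((t : ℝ) * θ) ^ j * (t : ℝ) ^ i := by
    intro i hi
    have h := hC i m t hm ht hmt θ hθpos.ne' hθπ
    rw [abs_of_pos hθpos] at h
    rw [← hθ]
    calc |iteratedDeriv i (bumpAngle m t) θ| ≤ C i * (t : ℝ) ^ i / ((t : ℝ) * θ) ^ j := h
      _ = C i / ((t : ℝ) * θ) ^ j * (t : ℝ) ^ i := by ring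
      _ ≤ Cs / ((t : ℝ) * θ) ^ j * (t : ℝ) ^ i := by
          refine mul_le_mul_of_nonneg_right (div_le_div_of_nonneg_right (hCi i hi) hden.le) (by positivity)
  have hmain := hcomp (bumpAngle m t) (contDiff_bumpAngle m t) t (by exact_mod_cast (show 1 ≤ t by omega)) y hy0 hy1
    hfar (Cs / ((t : ℝ) * θ) ^ j) (by positivity) hA
  rw [← hθ] at hmain
  calc |iteratedDeriv n (fun x => bumpAngle m t (Real.arccos x)) y| ≤ K * (Cs / ((t : ℝ) * θ) ^ j) * ((t : ℝ) / θ) ^ n :=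
        hmain
    _ = K * Cs * ((t : ℝ) / θ) ^ n / ((t : ℝ) * θ) ^ j := by ring

/-! ## The low-pass family in the multiplier variable `a`, `cos θ = 1 - a/(2B)` -/

/-- The low-pass function `G_{B,m,t}(a) = P_{m,t}(1 − a/(2B))`. [cite: Buchholz2016, Lemma 5.1 (5.2)] -/
def lowPass (B : ℝ) (m t : ℕ) (a : ℝ) : ℝ := (bumpPoly m t).eval (1 - a / (2 * B))

/-- The low-pass polynomial in `a`: `P_{m,t} ∘ (1 − X/(2B))`. [cite: Buchholz2016, Lemma 5.1 ("polynomial of degree at most t")] -/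
def lowPassPoly (B : ℝ) (m t : ℕ) : ℝ[X] := (bumpPoly m t).comp (C 1 - C (2 * B)⁻¹ * X)

/-- `lowPassPoly(a) = G(a)`. [cite: Buchholz2016, Lemma 5.1 (5.2)] -/
theorem lowPassPoly_eval (B : ℝ) (m t : ℕ) (a : ℝ) : (lowPassPoly B m t).eval a = lowPass B m t a := by
  rw [lowPassPoly, lowPass, eval_comp]
  congr 1
  simp only [eval_sub, eval_C, eval_mul, eval_X]
  ring

/-- `deg lowPassPoly ≤ m + t`. [cite: Buchholz2016, Lemma 5.1 ("polynomial of degree at most t")] -/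
theorem natDegree_lowPassPoly_le (B : ℝ) (m t : ℕ) : (lowPassPoly B m t).natDegree ≤ m + t := by
  rw [lowPassPoly]
  refine Polynomial.natDegree_comp_le.trans ?_
  have h1 : (C 1 - C (2 * B)⁻¹ * X : ℝ[X]).natDegree ≤ 1 := by
    refine (Polynomial.natDegree_sub_le _ _).trans ?_
    rw [Polynomial.natDegree_C, Nat.zero_max]
    exact (Polynomial.natDegree_C_mul_le _ _).trans Polynomial.natDegree_X_le
  calc (bumpPoly m t).natDegree * (C 1 - C (2 * B)⁻¹ * X : ℝ[X]).natDegree ≤ (m + t) * 1 :=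
        Nat.mul_le_mul (natDegree_bumpPoly_le m t) h1
    _ = m + t := mul_one _

/-- `G(0) = 1`. [cite: Buchholz2016, Lemma 5.1 (5.2)] -/
theorem lowPass_zero {B : ℝ} {m t : ℕ} (hm : 1 ≤ m) (ht : 2 ≤ t) : lowPass B m t 0 = 1 := by
  rw [lowPass, zero_div, sub_zero, bumpPoly_eval_one hm ht]

/-- `lowPassPoly(0) = 1`, so `X ∣ 1 − lowPassPoly`. [cite: Buchholz2016, Lemma 5.1 (5.2)] -/
theorem lowPassPoly_eval_zero {B : ℝ} {m t : ℕ} (hm : 1 ≤ m) (ht : 2 ≤ t) : (lowPassPoly B m t).eval 0 = 1 := by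
  rw [lowPassPoly_eval, lowPass_zero hm ht]

/-- For `0 ≤ a ≤ 4B` the argument `1 − a/(2B)` lies in `[-1,1]`. [cite: Buchholz2016, Lemma 5.1 (proof)] -/
theorem one_sub_div_mem_Icc {B a : ℝ} (hB : 0 < B) (ha0 : 0 ≤ a) (ha : a ≤ 4 * B) :
    1 - a / (2 * B) ∈ Set.Icc (-1 : ℝ) 1 := by
  constructor
  · have h : a / (2 * B) ≤ 2 := by rw [div_le_iff₀ (by positivity)]; linarith
    linarith
  · have : 0 ≤ a / (2 * B) := by positivity
    linarith

/-- `0 ≤ G(a)` on `[0, 4B]`. [cite: Buchholz2016, Lemma 5.1 (5.2)] -/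
theorem lowPass_nonneg {B : ℝ} (hB : 0 < B) (m t : ℕ) {a : ℝ} (ha0 : 0 ≤ a) (ha : a ≤ 4 * B) : 0 ≤ lowPass B m t a := by
  rw [lowPass, bumpPoly_eval_eq_bumpAngle_arccos m t (one_sub_div_mem_Icc hB ha0 ha)]
  exact (bumpAngle_mem_Icc m t _).1

/-- `G(a) ≤ 1` on `[0, 4B]`. [cite: Buchholz2016, Lemma 5.1 (5.2)] -/
theorem lowPass_le_one {B : ℝ} (hB : 0 < B) (m t : ℕ) {a : ℝ} (ha0 : 0 ≤ a) (ha : a ≤ 4 * B) : lowPass B m t a ≤ 1 := by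
  rw [lowPass, bumpPoly_eval_eq_bumpAngle_arccos m t (one_sub_div_mem_Icc hB ha0 ha)]
  exact (bumpAngle_mem_Icc m t _).2

/-- The angle of `a`: for `0 < a ≤ 2B`, `θ = arccos(1 − a/(2B)) ∈ (0, π/2]` with `a = 2B(1 − cos θ)` and
`a/B ≤ θ² ≤ π² a/(4B)`. [cite: Buchholz2016, §2 (4/π² t² ≤ |e^{it}−1|² ≤ t²)] -/
theorem angle_of_multiplier {B a : ℝ} (hB : 0 < B) (ha0 : 0 < a) (ha : a ≤ 2 * B) :
    0 < Real.arccos (1 - a / (2 * B)) ∧ Real.arccos (1 - a / (2 * B)) ≤ π / 2 ∧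
      a = 2 * B * (1 - Real.cos (Real.arccos (1 - a / (2 * B)))) ∧
      a / B ≤ Real.arccos (1 - a / (2 * B)) ^ 2 ∧ Real.arccos (1 - a / (2 * B)) ^ 2 ≤ π ^ 2 * a / (4 * B) := by
  set x := 1 - a / (2 * B) with hx
  have hq : 0 < a / (2 * B) := by positivity
  have hx1 : x < 1 := by rw [hx]; linarith
  have hx0 : 0 ≤ x := by rw [hx, sub_nonneg, div_le_one (by positivity)]; linarith
  set θ := Real.arccos x with hθ
  have hθpos : 0 < θ := Real.arccos_pos.2 hx1
  have hθle : θ ≤ π / 2 := Real.arccos_le_pi_div_two.2 hx0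
  have hcos : Real.cos θ = x := Real.cos_arccos (by linarith) hx1.le
  have ha_eq : a = 2 * B * (1 - Real.cos θ) := by rw [hcos, hx]; field_simp; ring
  have hθπ : |θ| ≤ π := by rw [abs_of_pos hθpos]; linarith [Real.pi_pos]
  refine ⟨hθpos, hθle, ha_eq, ?_, ?_⟩
  · -- `1 - cos θ ≤ θ²/2`
    have h := Real.one_sub_sq_div_two_le_cos (x := θ)
    rw [div_le_iff₀ hB]
    nlinarith
  · -- `1 - cos θ ≥ 2θ²/π²`
    have h := Real.cos_le_one_sub_mul_cos_sq hθπ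
    have hπ : 0 < π ^ 2 := by positivity
    rw [le_div_iff₀ (by positivity)]
    have : 2 / π ^ 2 * θ ^ 2 * (π ^ 2) = 2 * θ ^ 2 := by field_simp
    nlinarith [mul_le_mul_of_nonneg_right (show 2 / π ^ 2 * θ ^ 2 ≤ 1 - Real.cos θ by linarith) hπ.le]

/-- **Flatness** `1 − G(a) ≤ (m² + t²) π² a/(8B)` on `[0, 2B]` (`1 − fh ≤ (1−f) + (1−h)` and
`1 − A ≤ (tθ)²/2`). [cite: Buchholz2016, Lemma 5.1 (5.4)] -/
theorem one_sub_lowPass_le {B : ℝ} (hB : 0 < B) {m t : ℕ} (hm : 1 ≤ m) (ht : 2 ≤ t) {a : ℝ} (ha0 : 0 ≤ a)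
    (ha : a ≤ 2 * B) : 1 - lowPass B m t a ≤ ((m : ℝ) ^ 2 + (t : ℝ) ^ 2) * π ^ 2 * a / (8 * B) := by
  rcases eq_or_lt_of_le ha0 with h0 | hpos
  · rw [← h0, lowPass_zero hm ht]; simp
  obtain ⟨hθpos, _, _, _, hθ2⟩ := angle_of_multiplier hB hpos ha
  set θ := Real.arccos (1 - a / (2 * B)) with hθ
  rw [lowPass, bumpPoly_eval_eq_bumpAngle_arccos m t (one_sub_div_mem_Icc hB ha0 (by linarith)), ← hθ, bumpAngle]
  have hf := one_sub_acBump_le boxProf_nonneg (profMass_boxProf_pos hm) θ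
  have hh := one_sub_acBump_le plateau_nonneg (profMass_plateau_pos ht) θ
  have hf0 := acBump_nonneg boxProf m θ
  have hf1 := acBump_le_one boxProf_nonneg m θ
  have hh1 := acBump_le_one plateau_nonneg t θ
  have key : 1 - acBump boxProf m θ * acBump plateau t θ ≤ ((m : ℝ) ^ 2 + (t : ℝ) ^ 2) * θ ^ 2 / 2 := by
    have : 1 - acBump boxProf m θ * acBump plateau t θ =
        (1 - acBump boxProf m θ) + acBump boxProf m θ * (1 - acBump plateau t θ) := by ring
    rw [this]
    have h2 : acBump boxProf m θ * (1 - acBump plateau t θ) ≤ 1 * (((t : ℝ) * θ) ^ 2 / 2) :=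
      mul_le_mul hf1 hh (by linarith) zero_le_one
    nlinarith
  calc 1 - acBump boxProf m θ * acBump plateau t θ ≤ ((m : ℝ) ^ 2 + (t : ℝ) ^ 2) * θ ^ 2 / 2 := key
    _ ≤ ((m : ℝ) ^ 2 + (t : ℝ) ^ 2) * (π ^ 2 * a / (4 * B)) / 2 := by
        refine div_le_div_of_nonneg_right (mul_le_mul_of_nonneg_left hθ2 (by positivity)) (by norm_num)
    _ = ((m : ℝ) ^ 2 + (t : ℝ) ^ 2) * π ^ 2 * a / (8 * B) := by field_simp; ring

/-- **Lower bound** `1 − G(a) ≥ min((m+1)² a/(4π²B), 2/5)` on `(0, 2B]` (from the Fejér factor: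
`1 − fh ≥ 1 − f`). [cite: Buchholz2016, Lemma 5.1 (5.4)] -/
theorem one_sub_lowPass_ge {B : ℝ} (hB : 0 < B) {m : ℕ} (hm : 1 ≤ m) (t : ℕ) {a : ℝ} (ha0 : 0 < a) (ha : a ≤ 2 * B) :
    min ((((m : ℝ) + 1) ^ 2) * a / (4 * π ^ 2 * B)) (2 / 5) ≤ 1 - lowPass B m t a := by
  obtain ⟨hθpos, hθle, _, hθ1, _⟩ := angle_of_multiplier hB ha0 ha
  set θ := Real.arccos (1 - a / (2 * B)) with hθ
  rw [lowPass, bumpPoly_eval_eq_bumpAngle_arccos m t (one_sub_div_mem_Icc hB ha0.le (by linarith)), ← hθ, bumpAngle]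
  have hlow := one_sub_acBump_box_ge hm hθpos hθle
  have hf0 := acBump_nonneg boxProf m θ
  have hh0 := acBump_nonneg plateau t θ
  have hh1 := acBump_le_one plateau_nonneg t θ
  have key : 1 - acBump boxProf m θ ≤ 1 - acBump boxProf m θ * acBump plateau t θ := by nlinarith
  refine le_trans ?_ (hlow.trans key)
  -- compare the two minima: `(m+1)² a/(4π²B) ≤ ((m+1)θ)²/(4π²)` since `a/B ≤ θ²`
  refine min_le_min ?_ le_rfl
  rw [div_le_div_iff₀ (by positivity) (by positivity)]
  have hπ : 0 < 4 * π ^ 2 := by positivity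
  have h1 : a ≤ θ ^ 2 * B := by rwa [div_le_iff₀ hB] at hθ1
  nlinarith [mul_le_mul_of_nonneg_left h1 (show 0 ≤ ((m : ℝ) + 1) ^ 2 * (4 * π ^ 2) by positivity)]

/-- Polynomial functions are smooth. [folklore] -/
private theorem contDiff_polyEval (P : ℝ[X]) {n : WithTop ℕ∞} : ContDiff ℝ n (fun x => P.eval x) := by
  have h := P.contDiff_aeval (𝕜 := ℝ) n
  simpa only [Polynomial.coe_aeval_eq_eval] using h

/-- `G` is smooth (a polynomial). [cite: Buchholz2016, Lemma 5.1 (proof)] -/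
theorem contDiff_lowPass (B : ℝ) (m t : ℕ) {n : WithTop ℕ∞} : ContDiff ℝ n (lowPass B m t) := by
  have : lowPass B m t = fun a => (lowPassPoly B m t).eval a := funext fun a => (lowPassPoly_eval B m t a).symm
  rw [this]
  exact contDiff_polyEval _

/-- Chain rule: `G^{(i)}(a) = (−1/(2B))^i P^{(i)}(1 − a/(2B))`. [cite: Buchholz2016, Lemma 5.1 (proof)] -/
theorem iteratedDeriv_lowPass (B : ℝ) (m t i : ℕ) (a : ℝ) : iteratedDeriv i (lowPass B m t) a =
    (-(2 * B)⁻¹) ^ i * iteratedDeriv i (fun x => (bumpPoly m t).eval x) (1 - a / (2 * B)) := by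
  have hG : ContDiff ℝ i (fun u : ℝ => (bumpPoly m t).eval (1 + u)) :=
    (contDiff_polyEval _).comp (contDiff_const.add contDiff_id)
  have hfun : lowPass B m t = fun a => (fun u : ℝ => (bumpPoly m t).eval (1 + u)) (-(2 * B)⁻¹ * a) := by
    funext a; simp only [lowPass]; congr 1; ring
  rw [hfun, iteratedDeriv_comp_const_mul hG, iteratedDeriv_comp_const_add i (fun x => (bumpPoly m t).eval x)]
  simp only
  congr 2
  ring

/-- **Symbol estimate of all orders** (Buchholz's (5.3) `(1+t²λ)^n λ^ℓ|∂^ℓ W_t| ≤ C_{ℓ,n}` for the discrete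
family): for all `i, j` there is `C` such that for every band `B > 0`, all `1 ≤ m ≤ t`, `t ≥ 2` and
`0 < a ≤ 2B`, `|G_{B,m,t}^{(i)}(a)| ≤ C (t²/B)^i min(1, (t² a/B)^{-j})`. [cite: Buchholz2016, Lemma 5.1 (5.3)] -/
theorem exists_abs_iteratedDeriv_lowPass_le (i j : ℕ) : ∃ C, 0 ≤ C ∧ ∀ B : ℝ, 0 < B → ∀ m t : ℕ, 1 ≤ m → 2 ≤ t →
    m ≤ t → ∀ a : ℝ, 0 < a → a ≤ 2 * B →
      |iteratedDeriv i (lowPass B m t) a| ≤ C * ((t : ℝ) ^ 2 / B) ^ i * min 1 ((((t : ℝ) ^ 2 * a / B))⁻¹ ^ j) := by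
  obtain ⟨CT, hCT0, hCT⟩ := exists_abs_iteratedDeriv_bumpPoly_le_tail i (2 * j)
  refine ⟨1 + CT, by positivity, fun B hB m t hm ht hmt a ha0 ha => ?_⟩
  obtain ⟨hθpos, hθle, _, hθ1, hθ2⟩ := angle_of_multiplier hB ha0 ha
  set x := 1 - a / (2 * B) with hx
  set θ := Real.arccos x with hθ
  have htpos : (0 : ℝ) < t := by exact_mod_cast (show 0 < t by omega)
  have hq : 0 < a / (2 * B) := by positivity
  have hx1 : x < 1 := by rw [hx]; linarith
  have hx0 : 0 ≤ x := by rw [hx, sub_nonneg, div_le_one (by positivity)]; linarith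
  have hxI : x ∈ Set.Icc (-1 : ℝ) 1 := ⟨by linarith, hx1.le⟩
  set u : ℝ := (t : ℝ) ^ 2 * a / B with hu
  have hupos : 0 < u := by positivity
  have hu_le : u ≤ ((t : ℝ) * θ) ^ 2 := by
    rw [hu, mul_pow, mul_div_assoc]; exact mul_le_mul_of_nonneg_left hθ1 (by positivity)
  rw [iteratedDeriv_lowPass, abs_mul, abs_pow, abs_neg, abs_inv, abs_of_pos (by positivity : (0 : ℝ) < 2 * B), ← hx]
  have hscale : ((2 * B)⁻¹) ^ i * (2 ^ i * (t : ℝ) ^ (2 * i)) = ((t : ℝ) ^ 2 / B) ^ i := by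
    rw [pow_mul, ← mul_pow, ← mul_pow, div_eq_mul_inv]; congr 1; field_simp
  rcases le_or_gt u 1 with hu1 | hu1
  · -- bulk: `u ≤ 1`
    have hmin : min 1 (u⁻¹ ^ j) = 1 := min_eq_left (one_le_pow₀ (one_le_inv_iff₀.2 ⟨hupos, hu1⟩))
    rw [hmin, mul_one]
    calc ((2 * B)⁻¹) ^ i * |iteratedDeriv i (fun x => (bumpPoly m t).eval x) x|
        ≤ ((2 * B)⁻¹) ^ i * (2 ^ i * (t : ℝ) ^ (2 * i)) :=
          mul_le_mul_of_nonneg_left (abs_iteratedDeriv_bumpPoly_le hmt i hxI) (by positivity)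
      _ = ((t : ℝ) ^ 2 / B) ^ i := hscale
      _ ≤ (1 + CT) * ((t : ℝ) ^ 2 / B) ^ i := by
          have : 0 ≤ ((t : ℝ) ^ 2 / B) ^ i := by positivity
          nlinarith
  · -- tail: `u > 1`, hence `tθ ≥ 1`
    have htθ : 1 ≤ (t : ℝ) * θ := by
      by_contra h
      rw [not_le] at h
      have h0 : 0 ≤ (t : ℝ) * θ := by positivity
      have : ((t : ℝ) * θ) ^ 2 < 1 := by nlinarith
      linarith
    have hmin : min 1 (u⁻¹ ^ j) = u⁻¹ ^ j :=
      min_eq_right (pow_le_one₀ (by positivity) (inv_le_one_of_one_le₀ hu1.le))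
    rw [hmin]
    have htail := hCT m t hm ht hmt x hx0 hx1 htθ
    rw [← hθ] at htail
    have htθpos : 0 < (t : ℝ) * θ := by positivity
    -- `(t/θ)^i / (tθ)^{2j} = t^{2i} (tθ)^{-i} (tθ)^{-2j} ≤ t^{2i} u^{-j}`
    have e1 : ((t : ℝ) / θ) ^ i / ((t : ℝ) * θ) ^ (2 * j) ≤ (t : ℝ) ^ (2 * i) * u⁻¹ ^ j := by
      have hA : ((t : ℝ) / θ) ^ i = (t : ℝ) ^ (2 * i) / ((t : ℝ) * θ) ^ i := by
        rw [pow_mul, div_pow, mul_pow, sq, mul_pow]; field_simp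
      have hB' : (1 : ℝ) ≤ ((t : ℝ) * θ) ^ i := one_le_pow₀ htθ
      have hC' : u ^ j ≤ ((t : ℝ) * θ) ^ (2 * j) := by rw [pow_mul]; exact pow_le_pow_left₀ hupos.le hu_le j
      rw [hA, div_div, inv_pow, ← div_eq_mul_inv, div_le_div_iff₀ (by positivity) (by positivity)]
      calc (t : ℝ) ^ (2 * i) * u ^ j ≤ (t : ℝ) ^ (2 * i) * (((t : ℝ) * θ) ^ i * ((t : ℝ) * θ) ^ (2 * j)) := by
            refine mul_le_mul_of_nonneg_left ?_ (by positivity)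
            calc u ^ j = 1 * u ^ j := (one_mul _).symm
              _ ≤ ((t : ℝ) * θ) ^ i * ((t : ℝ) * θ) ^ (2 * j) := mul_le_mul hB' hC' (by positivity) (by positivity)
        _ = (t : ℝ) ^ (2 * i) * (((t : ℝ) * θ) ^ i * ((t : ℝ) * θ) ^ (2 * j)) := rfl
    calc ((2 * B)⁻¹) ^ i * |iteratedDeriv i (fun x => (bumpPoly m t).eval x) x|
        ≤ ((2 * B)⁻¹) ^ i * (CT * ((t : ℝ) / θ) ^ i / ((t : ℝ) * θ) ^ (2 * j)) :=
          mul_le_mul_of_nonneg_left htail (by positivity)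
      _ = CT * (((2 * B)⁻¹) ^ i * (((t : ℝ) / θ) ^ i / ((t : ℝ) * θ) ^ (2 * j))) := by ring
      _ ≤ CT * (((2 * B)⁻¹) ^ i * ((t : ℝ) ^ (2 * i) * u⁻¹ ^ j)) :=
          mul_le_mul_of_nonneg_left (mul_le_mul_of_nonneg_left e1 (by positivity)) hCT0
      _ = CT * (((2 * B)⁻¹) ^ i * (t : ℝ) ^ (2 * i)) * u⁻¹ ^ j := by ring
      _ ≤ (1 + CT) * ((t : ℝ) ^ 2 / B) ^ i * u⁻¹ ^ j := by
          have hle : ((2 * B)⁻¹) ^ i * (t : ℝ) ^ (2 * i) ≤ ((t : ℝ) ^ 2 / B) ^ i := by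
            rw [← hscale]
            refine mul_le_mul_of_nonneg_left ?_ (by positivity)
            have : (1 : ℝ) ≤ 2 ^ i := one_le_pow₀ (by norm_num)
            nlinarith [show 0 ≤ (t : ℝ) ^ (2 * i) by positivity]
          have h0 : 0 ≤ u⁻¹ ^ j := by positivity
          have h1 : 0 ≤ ((t : ℝ) ^ 2 / B) ^ i := by positivity
          nlinarith [mul_le_mul_of_nonneg_right hle h0, mul_nonneg h1 h0]

end Literature.Analysis.Fourier

end
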